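import Mathlib
import HarnessLib
import Summits.NavierStokesRegularity.NavierStokesRegularity.Theorems.PoloidalWindowRigidity.Negative.TriWaveGenericity
import Summits.NavierStokesRegularity.NavierStokesRegularity.Theorems.PoloidalWindowRigidity.Negative.TriWaveScrew
import Summits.NavierStokesRegularity.NavierStokesRegularity.Theorems.PoloidalWindowRigidity.Negative.TriWaveFrame
import Summits.NavierStokesRegularity.NavierStokesRegularity.Theorems.PoloidalWindowRigidity.Negative.TriWaveGauge

/-!
# Crux `PoloidalWindowRigidity` (K2, stmt-NavierStokesRegularity-19708) — negative side:
# the residue stub S2⁗ (rev 11, and rev 10) with (M) replaced by the ClassRates is FALSE — three-wave witness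

Negative-side support (refuter seat ns-regularity-refuter1 gen 2, cell ns-regularity-ideate; D-0081 §C).  Assembles
`…Negative.TriWaveProfile`, `…TriWaveGenericity`, `…TriWaveScrew`, `…TriWaveFrame`, `…TriWaveGauge`:

* `residueRev11_false_with_classRates_without_mild`: the hypothesis list of the OPEN STUB OF RECORD
  `stub_residueSupercriticalNearPeak` (skeleton `Cruxes/PoloidalWindowRigidity/Lines/slicesharp.lean`, line
  `slicesharp-screw`, REV 11 — clause (vii) super-critical production near every vorticity record AND clause (viii)
  no elliptic-shear-pinched slice) with its third hypothesis — the Oseen-mild identity (M) — replaced by the two banked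
  scale-sharp ClassRates `‖Dv(t)‖ ≤ C₁/(−t)`, `‖curl v(t)‖ ≤ C₂/(−t)`, and NOTHING ELSE changed (the twenty-one other
  hypotheses byte-identical: rate, continuity, divergence-free, poloidal, frozen, (hrot) non-constant vorticity
  direction, vertical non-rigidity, horizontal non-flatness, no translation invariance, axisymmetric in NO rigid
  frame, not scale-invariant, no screw invariance, the no-source-gauge clause, no vertical period, (iv) critical
  strain, (v′) no spatial period, (vi′) no spiral self-similarity, (vii), (viii)), does NOT exclude a backward singular
  point: the three-wave profile `triProfile` (`C = 12, C₁ = 24, C₂ = 12`) meets all of them and is singular at the apex.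
  Clause (viii) is met because the three-wave field is hyperbolic-shear-pinched (`∂₂T_h = −∇_h T₂`, slope `m = −1`,
  outside every `[μ₀, μ₁] ⊂ (0, ∞)`);
* `residueRev10_false_with_classRates_without_mild`: the same for the rev-10 list (without (viii)), a fortiori.

Reading for the lead / planner: after eleven revisions (M) is still the ONLY load-bearing hypothesis of the residue
stub; every kinematic, symmetry-excluding, production-type or shear-stratum clause added so far is met by one explicit
(M)-free poloidal frozen Type-I profile, so the closing argument must use the Oseen-mild identity itself (pressure,
large-scale energy decay, or unique continuation), not further kinematic exclusions of this kind.

WHAT THIS IS NOT: not a claim about Navier–Stokes (no mild/ancient solution is constructed; the witness is spatially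
quasi-periodic with infinite energy and is NOT mild); the crux K2 and the summit stay open. [folklore]
-/

noncomputable section

-- the summit and its single sub-problem share the name (CONVENTIONS §1), as in every Theorems file
set_option linter.dupNamespace false

namespace Summit.NavierStokesRegularity.NavierStokesRegularity.Theorems.PoloidalWindowRigidity.Negative

open Set Function
open scoped RealInnerProductSpace InnerProductSpace Laplacian
open Literature.Analysis Literature.Analysis.FluidPDE

/-- **The rev-11 residue stub S2⁗ with (M) replaced by the ClassRates is FALSE** — full hypothesis list, clauses
(vii) and (viii) included; witness the three-wave profile. [folklore] -/
theorem residueRev11_false_with_classRates_without_mild :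
    ¬ (∀ (C C₁ C₂ : ℝ) (v : ℝ → EuclideanSpace ℝ (Fin 3) → EuclideanSpace ℝ (Fin 3)),
      Literature.Analysis.FluidPDE.HasTypeITimeDecay C v →
      ContinuousOn (Function.uncurry v) (Set.Iio (0 : ℝ) ×ˢ Set.univ) →
      (∀ t < 0, ∀ y, ‖fderiv ℝ (v t) y‖ ≤ C₁ / (-t)) →
      (∀ t < 0, ∀ y, ‖Literature.Analysis.FluidPDE.curl (v t) y‖ ≤ C₂ / (-t)) →
      (∀ t < 0, Literature.Analysis.FluidPDE.VectorCalculus.IsDivFree (v t)) →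
      (∀ s < 0, ∀ y, ⟪Literature.Analysis.FluidPDE.curl (v s) y, EuclideanSpace.single 2 1⟫_ℝ = 0) →
      (∀ s < 0, ∀ y, ⟪fderiv ℝ (v s) y (Literature.Analysis.FluidPDE.curl (v s) y), EuclideanSpace.single 2 1⟫_ℝ = 0) →
      (∀ s < 0, ∀ b : EuclideanSpace ℝ (Fin 3), b ≠ 0 → ∃ y,
        Literature.Analysis.FluidPDE.cross (Literature.Analysis.FluidPDE.curl (v s) y) b ≠ 0) →
      (∀ s < 0, ∃ y, fderiv ℝ (v s) y (EuclideanSpace.single 2 1) 0 ≠ 0 ∨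
        fderiv ℝ (v s) y (EuclideanSpace.single 2 1) 1 ≠ 0) →
      (∀ s < 0, ∀ a : EuclideanSpace ℝ (Fin 3), a ≠ 0 → ⟪a, EuclideanSpace.single 2 1⟫_ℝ = 0 →
        ∃ y, ⟪fderiv ℝ (v s) y a, EuclideanSpace.single 2 1⟫_ℝ ≠ 0) →
      (∀ s < 0, ∀ e : EuclideanSpace ℝ (Fin 3), e ≠ 0 → ∃ (y : EuclideanSpace ℝ (Fin 3)) (l : ℝ), v s (y + l • e) ≠ v s y) →
      (∀ s < 0, ∀ (L : EuclideanSpace ℝ (Fin 3) ≃ₗᵢ[ℝ] EuclideanSpace ℝ (Fin 3)) (c : EuclideanSpace ℝ (Fin 3)),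
        ¬ Literature.Analysis.FluidPDE.IsAxisymmetric (fun y => L.symm (v s (L y + c)))) →
      (∃ lam : ℝ, 0 < lam ∧ ∃ s < 0, ∃ y, lam • v (lam ^ 2 * s) (lam • y) ≠ v s y) →
      (∀ κ : ℝ, κ ≠ 0 → ∀ c : EuclideanSpace ℝ (Fin 3), ∃ s < 0, ∃ (a : ℝ) (y : EuclideanSpace ℝ (Fin 3)),
        v s (c + Literature.Analysis.FluidPDE.rotZ (κ * a) (y - c) + a • EuclideanSpace.single 2 (1 : ℝ)) ≠
          Literature.Analysis.FluidPDE.rotZ (κ * a) (v s y)) →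
      (∀ (ψ : ℝ → EuclideanSpace ℝ (Fin 3) → ℝ) (src : ℝ → ℝ) (x₀ : EuclideanSpace ℝ (Fin 3)) (ε : ℝ → ℝ),
        ContDiffOn ℝ 2 (Function.uncurry ψ) (Set.Iio (0 : ℝ) ×ˢ Set.univ) →
        (∀ t < 0, ∀ y, Literature.Analysis.FluidPDE.curl (v t) y 0 = fderiv ℝ (ψ t) y (EuclideanSpace.single 1 1) ∧
          Literature.Analysis.FluidPDE.curl (v t) y 1 = -fderiv ℝ (ψ t) y (EuclideanSpace.single 0 1)) →
        (∀ t < 0, ∀ x, |ψ t x - ψ t x₀| ≤ ε t * ‖x - x₀‖) →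
        ContinuousOn ε (Set.Iio 0) →
        Filter.Tendsto (fun t => ε t * Real.sqrt (-t)) Filter.atBot (nhds 0) →
        ∃ t < 0, ∃ x, deriv (fun τ => ψ τ x) t + fderiv ℝ (ψ t) x (v t x) - (Δ (ψ t)) x ≠ src t) →
      (∀ L : ℝ, 0 < L → ∃ s < 0, ∃ y, v s (y + L • EuclideanSpace.single 2 (1 : ℝ)) ≠ v s y) →
      (∀ Λ : ℝ, Λ < 1 → ∃ s < 0, ∃ (y a : EuclideanSpace ℝ (Fin 3)), ⟪a, EuclideanSpace.single 2 (1 : ℝ)⟫_ℝ = 0 ∧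
        Λ * ‖a‖ ^ 2 < (-s) * ⟪fderiv ℝ (v s) y a, a⟫_ℝ) →
      (∀ ℓ : EuclideanSpace ℝ (Fin 3), ℓ ≠ 0 → ∃ s < 0, ∃ y, v s (y + ℓ) ≠ v s y) →
      (∀ (c : EuclideanSpace ℝ (Fin 3)) (κ : ℝ), ∃ (r : ℝ), ∃ s < 0, ∃ y,
        Real.exp r • v (Real.exp r ^ 2 * s) (Real.exp r • Literature.Analysis.FluidPDE.rotZ (κ * r) y + c) ≠
          Literature.Analysis.FluidPDE.rotZ (κ * r) (v s (y + c))) →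
      (∀ θ : ℝ, 0 ≤ θ → ∀ s₀ < 0, ∀ y₀ : EuclideanSpace ℝ (Fin 3),
        θ < (-s₀) ^ 2 * ⟪Literature.Analysis.FluidPDE.curl (v s₀) y₀, Literature.Analysis.FluidPDE.curl (v s₀) y₀⟫_ℝ →
        ∃ s < 0, ∃ y, θ < (-s) ^ 2 * ⟪Literature.Analysis.FluidPDE.curl (v s) y, Literature.Analysis.FluidPDE.curl (v s) y⟫_ℝ ∧
          ⟪Literature.Analysis.FluidPDE.curl (v s) y, Literature.Analysis.FluidPDE.curl (v s) y⟫_ℝ <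
            (-s) * ⟪Literature.Analysis.FluidPDE.curl (v s) y, fderiv ℝ (v s) y (Literature.Analysis.FluidPDE.curl (v s) y)⟫_ℝ) →
      (∀ s < 0, ∀ μ₀ μ₁ : ℝ, 0 < μ₀ → ∃ y, ∀ m : ℝ, μ₀ ≤ m → m ≤ μ₁ →
        fderiv ℝ (v s) y (EuclideanSpace.single 2 1) 0 ≠ m * fderiv ℝ (v s) y (EuclideanSpace.single 0 1) 2 ∨
        fderiv ℝ (v s) y (EuclideanSpace.single 2 1) 1 ≠ m * fderiv ℝ (v s) y (EuclideanSpace.single 1 1) 2) →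
      ¬ Literature.Analysis.FluidPDE.IsBackwardSingularPoint v 0) := by
  intro h
  refine h 12 24 12 triProfile hasTypeITimeDecay_triProfile continuousOn_triProfile
    (fun t ht y => norm_fderiv_triProfile_le ht y) (fun t ht y => norm_curl_triProfile_le ht y)
    (fun t _ => isDivFree_triProfile t) (fun s _ y => poloidal_triProfile s y) (fun s _ y => frozen_triProfile s y)
    (fun s hs b hb => vorticityDirection_nonconstant_triProfile hs b hb)
    (fun s hs => (not_vertRigid_triProfile hs).imp fun _ h => Or.inl h)
    (fun s hs a ha ha2 => flat_in_no_horizontal_direction_triProfile hs a ha ha2)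
    (fun s hs e he => not_translationInvariant_triProfile hs e he)
    (fun s hs L c => triProfile_not_axisymmetric_anyFrame hs L c)
    ⟨2, two_pos, -1, by norm_num, 0, not_scaleInvariant_triProfile⟩
    (fun κ hκ c => not_screwInvariant_triProfile κ hκ c)
    (fun ψ src _ _ hψ hstr _ _ _ => noSourceGauge_triProfile ψ src hψ hstr)
    (fun L hL => triProfile_no_vertical_period L hL)
    (fun Λ hΛ => triProfile_supercritical_strain Λ hΛ)
    (fun ℓ hℓ => triProfile_no_common_period ℓ hℓ)
    (fun c κ => not_spiralSelfSimilar_triProfile c κ)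
    triProfile_nearPeakSupercritical
    (fun s hs μ₀ μ₁ hμ₀ => not_ellipticShearPinched_triProfile hs μ₀ μ₁ hμ₀)
    isBackwardSingularPoint_triProfile

/-- **The rev-10 residue stub with (M) replaced by the ClassRates is FALSE** (the rev-11 list without clause (viii)).
[folklore] -/
theorem residueRev10_false_with_classRates_without_mild :
    ¬ (∀ (C C₁ C₂ : ℝ) (v : ℝ → EuclideanSpace ℝ (Fin 3) → EuclideanSpace ℝ (Fin 3)),
      Literature.Analysis.FluidPDE.HasTypeITimeDecay C v →
      ContinuousOn (Function.uncurry v) (Set.Iio (0 : ℝ) ×ˢ Set.univ) →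
      (∀ t < 0, ∀ y, ‖fderiv ℝ (v t) y‖ ≤ C₁ / (-t)) →
      (∀ t < 0, ∀ y, ‖Literature.Analysis.FluidPDE.curl (v t) y‖ ≤ C₂ / (-t)) →
      (∀ t < 0, Literature.Analysis.FluidPDE.VectorCalculus.IsDivFree (v t)) →
      (∀ s < 0, ∀ y, ⟪Literature.Analysis.FluidPDE.curl (v s) y, EuclideanSpace.single 2 1⟫_ℝ = 0) →
      (∀ s < 0, ∀ y, ⟪fderiv ℝ (v s) y (Literature.Analysis.FluidPDE.curl (v s) y), EuclideanSpace.single 2 1⟫_ℝ = 0) →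
      (∀ s < 0, ∀ b : EuclideanSpace ℝ (Fin 3), b ≠ 0 → ∃ y,
        Literature.Analysis.FluidPDE.cross (Literature.Analysis.FluidPDE.curl (v s) y) b ≠ 0) →
      (∀ s < 0, ∃ y, fderiv ℝ (v s) y (EuclideanSpace.single 2 1) 0 ≠ 0 ∨
        fderiv ℝ (v s) y (EuclideanSpace.single 2 1) 1 ≠ 0) →
      (∀ s < 0, ∀ a : EuclideanSpace ℝ (Fin 3), a ≠ 0 → ⟪a, EuclideanSpace.single 2 1⟫_ℝ = 0 →
        ∃ y, ⟪fderiv ℝ (v s) y a, EuclideanSpace.single 2 1⟫_ℝ ≠ 0) →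
      (∀ s < 0, ∀ e : EuclideanSpace ℝ (Fin 3), e ≠ 0 → ∃ (y : EuclideanSpace ℝ (Fin 3)) (l : ℝ), v s (y + l • e) ≠ v s y) →
      (∀ s < 0, ∀ (L : EuclideanSpace ℝ (Fin 3) ≃ₗᵢ[ℝ] EuclideanSpace ℝ (Fin 3)) (c : EuclideanSpace ℝ (Fin 3)),
        ¬ Literature.Analysis.FluidPDE.IsAxisymmetric (fun y => L.symm (v s (L y + c)))) →
      (∃ lam : ℝ, 0 < lam ∧ ∃ s < 0, ∃ y, lam • v (lam ^ 2 * s) (lam • y) ≠ v s y) →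
      (∀ κ : ℝ, κ ≠ 0 → ∀ c : EuclideanSpace ℝ (Fin 3), ∃ s < 0, ∃ (a : ℝ) (y : EuclideanSpace ℝ (Fin 3)),
        v s (c + Literature.Analysis.FluidPDE.rotZ (κ * a) (y - c) + a • EuclideanSpace.single 2 (1 : ℝ)) ≠
          Literature.Analysis.FluidPDE.rotZ (κ * a) (v s y)) →
      (∀ (ψ : ℝ → EuclideanSpace ℝ (Fin 3) → ℝ) (src : ℝ → ℝ) (x₀ : EuclideanSpace ℝ (Fin 3)) (ε : ℝ → ℝ),
        ContDiffOn ℝ 2 (Function.uncurry ψ) (Set.Iio (0 : ℝ) ×ˢ Set.univ) →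
        (∀ t < 0, ∀ y, Literature.Analysis.FluidPDE.curl (v t) y 0 = fderiv ℝ (ψ t) y (EuclideanSpace.single 1 1) ∧
          Literature.Analysis.FluidPDE.curl (v t) y 1 = -fderiv ℝ (ψ t) y (EuclideanSpace.single 0 1)) →
        (∀ t < 0, ∀ x, |ψ t x - ψ t x₀| ≤ ε t * ‖x - x₀‖) →
        ContinuousOn ε (Set.Iio 0) →
        Filter.Tendsto (fun t => ε t * Real.sqrt (-t)) Filter.atBot (nhds 0) →
        ∃ t < 0, ∃ x, deriv (fun τ => ψ τ x) t + fderiv ℝ (ψ t) x (v t x) - (Δ (ψ t)) x ≠ src t) →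
      (∀ L : ℝ, 0 < L → ∃ s < 0, ∃ y, v s (y + L • EuclideanSpace.single 2 (1 : ℝ)) ≠ v s y) →
      (∀ Λ : ℝ, Λ < 1 → ∃ s < 0, ∃ (y a : EuclideanSpace ℝ (Fin 3)), ⟪a, EuclideanSpace.single 2 (1 : ℝ)⟫_ℝ = 0 ∧
        Λ * ‖a‖ ^ 2 < (-s) * ⟪fderiv ℝ (v s) y a, a⟫_ℝ) →
      (∀ ℓ : EuclideanSpace ℝ (Fin 3), ℓ ≠ 0 → ∃ s < 0, ∃ y, v s (y + ℓ) ≠ v s y) →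
      (∀ (c : EuclideanSpace ℝ (Fin 3)) (κ : ℝ), ∃ (r : ℝ), ∃ s < 0, ∃ y,
        Real.exp r • v (Real.exp r ^ 2 * s) (Real.exp r • Literature.Analysis.FluidPDE.rotZ (κ * r) y + c) ≠
          Literature.Analysis.FluidPDE.rotZ (κ * r) (v s (y + c))) →
      (∀ θ : ℝ, 0 ≤ θ → ∀ s₀ < 0, ∀ y₀ : EuclideanSpace ℝ (Fin 3),
        θ < (-s₀) ^ 2 * ⟪Literature.Analysis.FluidPDE.curl (v s₀) y₀, Literature.Analysis.FluidPDE.curl (v s₀) y₀⟫_ℝ →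
        ∃ s < 0, ∃ y, θ < (-s) ^ 2 * ⟪Literature.Analysis.FluidPDE.curl (v s) y, Literature.Analysis.FluidPDE.curl (v s) y⟫_ℝ ∧
          ⟪Literature.Analysis.FluidPDE.curl (v s) y, Literature.Analysis.FluidPDE.curl (v s) y⟫_ℝ <
            (-s) * ⟪Literature.Analysis.FluidPDE.curl (v s) y, fderiv ℝ (v s) y (Literature.Analysis.FluidPDE.curl (v s) y)⟫_ℝ) →
      ¬ Literature.Analysis.FluidPDE.IsBackwardSingularPoint v 0) := by
  intro h
  refine h 12 24 12 triProfile hasTypeITimeDecay_triProfile continuousOn_triProfile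
    (fun t ht y => norm_fderiv_triProfile_le ht y) (fun t ht y => norm_curl_triProfile_le ht y)
    (fun t _ => isDivFree_triProfile t) (fun s _ y => poloidal_triProfile s y) (fun s _ y => frozen_triProfile s y)
    (fun s hs b hb => vorticityDirection_nonconstant_triProfile hs b hb)
    (fun s hs => (not_vertRigid_triProfile hs).imp fun _ h => Or.inl h)
    (fun s hs a ha ha2 => flat_in_no_horizontal_direction_triProfile hs a ha ha2)
    (fun s hs e he => not_translationInvariant_triProfile hs e he)
    (fun s hs L c => triProfile_not_axisymmetric_anyFrame hs L c)
    ⟨2, two_pos, -1, by norm_num, 0, not_scaleInvariant_triProfile⟩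
    (fun κ hκ c => not_screwInvariant_triProfile κ hκ c)
    (fun ψ src _ _ hψ hstr _ _ _ => noSourceGauge_triProfile ψ src hψ hstr)
    (fun L hL => triProfile_no_vertical_period L hL)
    (fun Λ hΛ => triProfile_supercritical_strain Λ hΛ)
    (fun ℓ hℓ => triProfile_no_common_period ℓ hℓ)
    (fun c κ => not_spiralSelfSimilar_triProfile c κ)
    triProfile_nearPeakSupercritical
    isBackwardSingularPoint_triProfile

end Summit.NavierStokesRegularity.NavierStokesRegularity.Theorems.PoloidalWindowRigidity.Negative

end
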